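import Summits.KontsevichZagierPeriods.KontsevichZagierPeriods.Theorems.LinRedNormalFormArrangementNormalFormStubRebaseSimplePosJanus
import Summits.KontsevichZagierPeriods.KontsevichZagierPeriods.Theorems.LinRedNormalFormArrangementNormalFormStubRebaseSimplePosProduct

/-!
# Stub `stub_rebaseSimplePos`, part `rebaseSimplePos_oneFibre` (crux `ArrangementNormalForm`,
line `janus-bands`, v6.2) — sub-part `Split`

Rule (1a) inside ONE fibre of the literal class text `GG b σ K`, any base dimension:
* `RebasePos.cutFibre` — cut the range of the fibre `i` at an affine level `θ(x', y)` lying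
  between its two bounds (on the literal cells): the two pieces are again literal
  (`hi i := θ` resp. `lo i := θ`), carry the same integrand, and `[s] − [s₁] − [s₂] ∈ KZ.relations`
  (the level set `tᵢ = θ` is null);
* `RebasePos.good_levelSplit` — the first uniformly closed case of the one-fibre rebase beyond
  the product case: product fibres, every lettered fibre except `i₀` has a bound parallel (in `y`)
  to its letter, and fibre `i₀` admits an affine level `κ` PARALLEL TO ITS LETTER between its two
  bounds on the base cell (e.g. the apex level of two transverse bounds when it separates them):
  cut fibre `i₀` at `κ`, then both pieces are in the product case (`RebasePos.good_product`).
  Registered as `rebaseSimplePos_levelSplit` (literal text).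

References: M. Kontsevich, D. Zagier, *Periods* (2001), §1.2, rule (1).
-/

noncomputable section

open Set MeasureTheory MvPolynomial
open Literature.NumberTheory.Transcendental Literature.ModelTheory.ExponentialFields

namespace Summit.KontsevichZagierPeriods.ArrangementNormalForm.JanusBands

namespace RebasePos

open SeparatePos

section Split

variable {b K m m' : ℕ}

/-- Membership in a literal domain, with the fibre `i` singled out. -/
theorem mem_gDom_iff_fibre (M : Fin m' → (Fin (b + 1) → ℚ) × ℚ)
    (g g' : Fin K → Fin K ⊕ ((Fin (b + 1) → ℚ) × ℚ)) (i : Fin K) (z : Fin (b + 1 + K) → ℝ) :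
    z ∈ gDom b K m' M g g' ↔ (∀ j, 0 < affF b K (M j) z) ∧
      (pv (g i) z < z (Fin.natAdd (b + 1) i) ∧ z (Fin.natAdd (b + 1) i) < pv (g' i) z) ∧
      ∀ i', i' ≠ i → pv (g i') z < z (Fin.natAdd (b + 1) i') ∧
        z (Fin.natAdd (b + 1) i') < pv (g' i') z := by
  simp only [gDom, mem_setOf_eq, affF, pv]
  refine and_congr_right fun _ => ⟨fun h => ⟨h i, fun i' _ => h i'⟩, fun h i' => ?_⟩
  by_cases hi' : i' = i
  · rw [hi']; exact h.1
  · exact h.2 i' hi'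

/-- The player of an updated bound at the updated fibre. -/
theorem pv_update_self (g : Fin K → Fin K ⊕ ((Fin (b + 1) → ℚ) × ℚ)) (i : Fin K)
    (c : (Fin (b + 1) → ℚ) × ℚ) (z : Fin (b + 1 + K) → ℝ) :
    pv (Function.update g i (Sum.inr c) i) z = affF b K c z := by
  simp [pv, affF]

/-- The player of an updated bound at another fibre. -/
theorem pv_update_of_ne (g : Fin K → Fin K ⊕ ((Fin (b + 1) → ℚ) × ℚ)) (i : Fin K)
    (c : (Fin (b + 1) → ℚ) × ℚ) (z : Fin (b + 1 + K) → ℝ) {i' : Fin K} (h : i' ≠ i) :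
    pv (Function.update g i (Sum.inr c) i') z = pv (g i') z := by
  rw [Function.update_of_ne h]

/-- Combining a two-piece relation with the goodness of the pieces. -/
theorem good_of_split {S : Set KZ.FormalRep} {x x₁ x₂ : KZ.FormalRep}
    (h : x - x₁ - x₂ ∈ KZ.relations) (h₁ : ∃ c ∈ AddSubgroup.closure S, x₁ - c ∈ KZ.relations)
    (h₂ : ∃ c ∈ AddSubgroup.closure S, x₂ - c ∈ KZ.relations) :
    ∃ c ∈ AddSubgroup.closure S, x - c ∈ KZ.relations := by
  obtain ⟨c₁, hc₁, hx₁⟩ := h₁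
  obtain ⟨c₂, hc₂, hx₂⟩ := h₂
  refine ⟨c₁ + c₂, add_mem hc₁ hc₂, ?_⟩
  have := add_mem h (add_mem hx₁ hx₂)
  rwa [show x - x₁ - x₂ + (x₁ - c₁ + (x₂ - c₂)) = x - (c₁ + c₂) by abel] at this

/-- **Cutting one fibre at an affine level** (rule 1a). If the affine level `θ(x', y)` lies
between the bounds of the fibre `i` on the literal cells (`h₁`, `h₂`), the restrictions of `s` to
`{tᵢ < θ}` and `{θ < tᵢ}` have literal domains (`hi i := θ`, resp. `lo i := θ`), the same
integrand, and `[s] − [s₁] − [s₂] ∈ KZ.relations` (the level set `tᵢ = θ` is null). -/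
theorem cutFibre (s : KZ.IntegralRep (b + 1 + K)) (M : Fin m' → (Fin (b + 1) → ℚ) × ℚ)
    (lo hi : Fin K → Fin K ⊕ ((Fin (b + 1) → ℚ) × ℚ)) (hdom : s.domain = gDom b K m' M lo hi)
    (i : Fin K) (θ : (Fin (b + 1) → ℚ) × ℚ)
    (h₁ : ∀ z ∈ gDom b K m' M lo (Function.update hi i (Sum.inr θ)), affF b K θ z ≤ pv (hi i) z)
    (h₂ : ∀ z ∈ gDom b K m' M (Function.update lo i (Sum.inr θ)) hi, pv (lo i) z ≤ affF b K θ z) :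
    ∃ s₁ s₂ : KZ.IntegralRep (b + 1 + K),
      s₁.domain = gDom b K m' M lo (Function.update hi i (Sum.inr θ)) ∧
      s₂.domain = gDom b K m' M (Function.update lo i (Sum.inr θ)) hi ∧
      s₁.integrand = s.integrand ∧ s₂.integrand = s.integrand ∧
      s₁.domain ⊆ s.domain ∧ s₂.domain ⊆ s.domain ∧
      KZ.of s - KZ.of s₁ - KZ.of s₂ ∈ KZ.relations := by
  set D₁ := gDom b K m' M lo (Function.update hi i (Sum.inr θ)) with hD₁
  set D₂ := gDom b K m' M (Function.update lo i (Sum.inr θ)) hi with hD₂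
  have hsub₁ : D₁ ⊆ s.domain := fun z hz => by
    have hθ := h₁ z hz
    rw [hD₁, mem_gDom_iff_fibre M _ _ i] at hz
    obtain ⟨hrow, ⟨hl, hu⟩, hrest⟩ := hz
    rw [pv_update_self] at hu
    rw [hdom, mem_gDom_iff_fibre M _ _ i]
    exact ⟨hrow, ⟨hl, lt_of_lt_of_le hu hθ⟩, fun i' hi' => by
      simpa only [pv_update_of_ne _ _ _ _ hi'] using hrest i' hi'⟩
  have hsub₂ : D₂ ⊆ s.domain := fun z hz => by
    have hθ := h₂ z hz
    rw [hD₂, mem_gDom_iff_fibre M _ _ i] at hz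
    obtain ⟨hrow, ⟨hl, hu⟩, hrest⟩ := hz
    rw [pv_update_self] at hl
    rw [hdom, mem_gDom_iff_fibre M _ _ i]
    exact ⟨hrow, ⟨lt_of_le_of_lt hθ hl, hu⟩, fun i' hi' => by
      simpa only [pv_update_of_ne _ _ _ _ hi'] using hrest i' hi'⟩
  have hdisj : D₁ ∩ D₂ = ∅ := by
    refine Set.eq_empty_iff_forall_notMem.2 fun z hz => ?_
    obtain ⟨hz₁, hz₂⟩ := hz
    rw [hD₁, mem_gDom_iff_fibre M _ _ i] at hz₁
    rw [hD₂, mem_gDom_iff_fibre M _ _ i] at hz₂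
    have hu := hz₁.2.1.2
    have hl := hz₂.2.1.1
    rw [pv_update_self] at hu hl
    exact lt_asymm hu hl
  have hcov : s.domain \ (D₁ ∪ D₂) ⊆ {z | z (Fin.natAdd (b + 1) i) = affF b K θ z} := by
    intro z hz
    obtain ⟨hzD, hzN⟩ := hz
    rw [hdom, mem_gDom_iff_fibre M _ _ i] at hzD
    obtain ⟨hrow, ⟨hl, hu⟩, hrest⟩ := hzD
    rcases lt_trichotomy (z (Fin.natAdd (b + 1) i)) (affF b K θ z) with ht | ht | ht
    · refine absurd (Or.inl ?_) hzN
      rw [hD₁, mem_gDom_iff_fibre M _ _ i]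
      exact ⟨hrow, ⟨hl, by rwa [pv_update_self]⟩, fun i' hi' => by
        simpa only [pv_update_of_ne _ _ _ _ hi'] using hrest i' hi'⟩
    · exact ht
    · refine absurd (Or.inr ?_) hzN
      rw [hD₂, mem_gDom_iff_fibre M _ _ i]
      exact ⟨hrow, ⟨by rwa [pv_update_self], hu⟩, fun i' hi' => by
        simpa only [pv_update_of_ne _ _ _ _ hi'] using hrest i' hi'⟩
  set s₁ := s.restrict D₁ (isSemialgebraic_gDom _ _ _ _) hsub₁ with hs₁
  set s₂ := s.restrict D₂ (isSemialgebraic_gDom _ _ _ _) hsub₂ with hs₂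
  have hrel : KZ.of s - KZ.of s₁ - KZ.of s₂ ∈ KZ.relations := by
    have h0 := KZ.of_sub_sum_of_mem_relations (Finset.univ : Finset (Fin 2)) s ![s₁, s₂]
      (fun j _ => by
        fin_cases j
        · simp [hs₁, sdiff_eq_empty.mpr hsub₁]
        · simp [hs₂, sdiff_eq_empty.mpr hsub₂])
      (fun j _ => by fin_cases j <;> exact fun _ _ => rfl)
      (by
        refine measure_mono_null (fun z hz => hcov ?_) (volume_fibre_eq_affF i θ)
        simp only [mem_sdiff, mem_iUnion, Finset.mem_univ, exists_true_left, not_exists,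
          Fin.forall_fin_two, Matrix.cons_val_zero, Matrix.cons_val_one] at hz
        obtain ⟨hz, hz₁, hz₂⟩ := hz
        exact ⟨hz, fun h => h.elim hz₁ hz₂⟩)
      (fun j _ j' _ hjj' => by
        fin_cases j <;> fin_cases j'
        · exact absurd rfl hjj'
        · show volume (D₁ ∩ D₂) = 0
          rw [hdisj, measure_empty]
        · show volume (D₂ ∩ D₁) = 0
          rw [inter_comm, hdisj, measure_empty]
        · exact absurd rfl hjj')
    rw [Fin.sum_univ_two] at h0
    simpa [sub_sub] using h0
  exact ⟨s₁, s₂, rfl, rfl, rfl, rfl, hsub₁, hsub₂, hrel⟩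

/-- **A level parallel to the letter between the bounds** (uniformly in the silent base
coordinates). Product fibres (`hlo`, `hhi`); every lettered fibre other than `i₀` has a bound
parallel in `y` to its letter (`hslope`); the fibre `i₀` admits an affine level `κ`, parallel in
`y` to its letter if it is lettered (`hκ`), lying between its bounds on the base cell
(`hbetween`). Then `[s]` is congruent to the subgroup generated by `GG B 2 K`: cut fibre `i₀` at
`κ` (rule 1a, `cutFibre`); both pieces are in the product case (`good_product`). -/
theorem good_levelSplit {B : ℕ} {n₁ n₂ : ℕ} (a : Fin K → Option ((Fin (B + 1) → ℚ) × ℚ))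
    (u v : Fin K → (Fin (B + 1) → ℚ) × ℚ) (s : KZ.IntegralRep (B + 1 + K))
    (M : Fin m' → (Fin (B + 1) → ℚ) × ℚ) (L : Fin m → (Fin B → ℚ) × ℚ) (e : Fin m → ℕ)
    (p : MvPolynomial (Fin B) ℚ) (ℓ₁ ℓ₂ : (Fin B → ℚ) × ℚ)
    (lo hi : Fin K → Fin K ⊕ ((Fin (B + 1) → ℚ) × ℚ))
    (h12 : n₁ = 0 ∨ n₂ = 0) (hbd : Bornology.IsBounded s.domain) (hdom : s.domain = gDom B K m' M lo hi)
    (hint : EqOn s.integrand (glit B K p L e ℓ₁ ℓ₂ n₁ n₂ a) s.domain)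
    (hlo : ∀ i, lo i = Sum.inr (u i)) (hhi : ∀ i, hi i = Sum.inr (v i)) (i₀ : Fin K)
    (κ : (Fin (B + 1) → ℚ) × ℚ)
    (hslope : ∀ i c, i ≠ i₀ → a i = some c →
      (u i).1 (Fin.last B) = c.1 (Fin.last B) ∨ (v i).1 (Fin.last B) = c.1 (Fin.last B))
    (hκ : ∀ c, a i₀ = some c → κ.1 (Fin.last B) = c.1 (Fin.last B))
    (hbetween : ∀ z : Fin (B + 1 + K) → ℝ, (∀ j, 0 < affF B K (M j) z) →
      affF B K (u i₀) z ≤ affF B K κ z ∧ affF B K κ z ≤ affF B K (v i₀) z) :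
    ∃ c ∈ AddSubgroup.closure (GGset B 2 K), KZ.of s - c ∈ KZ.relations := by
  have hv : ∀ z, pv (hi i₀) z = affF B K (v i₀) z := fun z => by rw [hhi]; rfl
  have hu : ∀ z, pv (lo i₀) z = affF B K (u i₀) z := fun z => by rw [hlo]; rfl
  obtain ⟨s₁, s₂, hd₁, hd₂, hi₁, hi₂, hsub₁, hsub₂, hrel⟩ := cutFibre s M lo hi hdom i₀ κ
    (fun z hz => by rw [hv]; exact (hbetween z hz.1).2)
    (fun z hz => by rw [hu]; exact (hbetween z hz.1).1)
  refine good_of_split hrel ?_ ?_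
  · refine good_product a u (Function.update v i₀ κ) s₁ M L e p ℓ₁ ℓ₂ lo
      (Function.update hi i₀ (Sum.inr κ)) h12 (hbd.subset hsub₁) hd₁
      (fun z hz => by rw [hi₁]; exact hint (hsub₁ hz)) hlo (fun i => ?_) (fun i c hc => ?_)
    · by_cases h : i = i₀
      · subst h; simp
      · rw [Function.update_of_ne h, Function.update_of_ne h, hhi]
    · by_cases h : i = i₀
      · subst h
        rw [Function.update_self]
        exact Or.inr (hκ c hc)
      · rw [Function.update_of_ne h]
        exact hslope i c h hc
  · refine good_product a (Function.update u i₀ κ) v s₂ M L e p ℓ₁ ℓ₂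
      (Function.update lo i₀ (Sum.inr κ)) hi h12 (hbd.subset hsub₂) hd₂
      (fun z hz => by rw [hi₂]; exact hint (hsub₂ hz)) (fun i => ?_) hhi (fun i c hc => ?_)
    · by_cases h : i = i₀
      · subst h; simp
      · rw [Function.update_of_ne h, Function.update_of_ne h, hlo]
    · by_cases h : i = i₀
      · subst h
        rw [Function.update_self]
        exact Or.inl (hκ c hc)
      · rw [Function.update_of_ne h]
        exact hslope i c h hc

end Split

end RebasePos

/-- **Registered part of `stub_rebaseSimplePos` / `rebaseSimplePos_oneFibre` (line `janus-bands`,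
v6.2): a level parallel to the letter between the bounds.** A representation with the literal
`GG B σ K` datum (any `n₁ n₂` with `n₁ = 0 ∨ n₂ = 0`), product fibres (`hlo`, `hhi`), every
lettered fibre `i ≠ i₀` with a bound parallel in `y` to its letter, and an affine level `κ` of the
base, parallel in `y` to the letter of `i₀`, between the bounds of `i₀` on the base cell, is
congruent modulo `KZ.relations` to the subgroup generated by the literal class `GG B 2 K`
(`RebasePos.good_levelSplit`: one fibre cut, rule 1a, then two per-fibre affine pull-backs,
rule 2). For ONE fibre over a base of dimension `≥ 2` this closes, uniformly in the silent base
coordinates, the sub-case of `stub_rebaseOne`'s case tree "apex level strictly between the two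
transverse bounds". -/
theorem rebaseSimplePos_levelSplit (B K m m' n₁ n₂ : ℕ) (s : KZ.IntegralRep (B + 1 + K)) (M : Fin m' → (Fin (B + 1) → ℚ) × ℚ) (L : Fin m → (Fin B → ℚ) × ℚ) (e : Fin m → ℕ) (p : MvPolynomial (Fin B) ℚ) (ℓ₁ ℓ₂ : (Fin B → ℚ) × ℚ) (a : Fin K → Option ((Fin (B + 1) → ℚ) × ℚ)) (lo hi : Fin K → Fin K ⊕ ((Fin (B + 1) → ℚ) × ℚ)) (u v : Fin K → (Fin (B + 1) → ℚ) × ℚ) (i₀ : Fin K) (κ : (Fin (B + 1) → ℚ) × ℚ) (h12 : n₁ = 0 ∨ n₂ = 0) (hbd : Bornology.IsBounded s.domain) (hdom : s.domain = {z | (∀ j, 0 < ∑ i, ((M j).1 i : ℝ) * z (Fin.castAdd K i) + ((M j).2 : ℝ)) ∧ ∀ i, Sum.elim (fun j => z (Fin.natAdd (B + 1) j)) (fun c => ∑ i', (c.1 i' : ℝ) * z (Fin.castAdd K i') + (c.2 : ℝ)) (lo i) < z (Fin.natAdd (B + 1) i) ∧ z (Fin.natAdd (B + 1) i) < Sum.elim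 (fun j => z (Fin.natAdd (B + 1) j)) (fun c => ∑ i', (c.1 i' : ℝ) * z (Fin.castAdd K i') + (c.2 : ℝ)) (hi i)}) (hint : EqOn s.integrand (fun z => MvPolynomial.aeval (fun i => z (Fin.castAdd K (Fin.castSucc i))) p / (∏ j, (∑ i, ((L j).1 i : ℝ) * z (Fin.castAdd K (Fin.castSucc i)) + ((L j).2 : ℝ)) ^ e j) * ((z (Fin.castAdd K (Fin.last B)) - (∑ i, (ℓ₁.1 i : ℝ) * z (Fin.castAdd K (Fin.castSucc i)) + (ℓ₁.2 : ℝ))) ^ n₁ / (z (Fin.castAdd K (Fin.last B)) - (∑ i, (ℓ₂.1 i : ℝ) * z (Fin.castAdd K (Fin.castSucc i)) + (ℓ₂.2 : ℝ))) ^ n₂) * ∏ i, (a i).elim 1 (fun c => 1 / (z (Fin.natAdd (B + 1) i) - (∑ i', (c.1 i' : ℝ) * z (Fin.castAdd K i') + (c.2 : ℝ))))) s.domain) (hlo : ∀ i, lo i = Sum.inr (u i)) (hhi : ∀ i, hi i = Sum.inr (v i)) (hslope : ∀ i c, i ≠ i₀ → a i = some c → (u i).1 (Fin.last B) = c.1 (Fin.last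 B) ∨ (v i).1 (Fin.last B) = c.1 (Fin.last B)) (hκ : ∀ c, a i₀ = some c → κ.1 (Fin.last B) = c.1 (Fin.last B)) (hbetween : ∀ z : Fin (B + 1 + K) → ℝ, (∀ j, 0 < ∑ i, ((M j).1 i : ℝ) * z (Fin.castAdd K i) + ((M j).2 : ℝ)) → (∑ i, ((u i₀).1 i : ℝ) * z (Fin.castAdd K i) + ((u i₀).2 : ℝ)) ≤ (∑ i, (κ.1 i : ℝ) * z (Fin.castAdd K i) + (κ.2 : ℝ)) ∧ (∑ i, (κ.1 i : ℝ) * z (Fin.castAdd K i) + (κ.2 : ℝ)) ≤ (∑ i, ((v i₀).1 i : ℝ) * z (Fin.castAdd K i) + ((v i₀).2 : ℝ))) : ∃ c ∈ AddSubgroup.closure {w : KZ.FormalRep | ∃ (m m' n₁ n₂ : ℕ) (s : KZ.IntegralRep (B + 1 + K)) (M : Fin m' → (Fin (B + 1) → ℚ) × ℚ) (L : Fin m → (Fin B → ℚ) × ℚ) (e : Fin m → ℕ) (p : MvPolynomial (Fin B) ℚ) (ℓ₁ ℓ₂ : (Fin B → ℚ) × ℚ) (a : Fin K → Option ((Fin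 (B + 1) → ℚ) × ℚ)) (lo hi : Fin K → Fin K ⊕ ((Fin (B + 1) → ℚ) × ℚ)), (n₁ = 0 ∨ n₂ = 0) ∧ (2 = 2 → (∀ i c, a i = some c → c.1 (Fin.last B) = 0) ∧ (∀ i c, (lo i = Sum.inr c ∨ hi i = Sum.inr c) → (c.1 (Fin.last B) = 0 ∨ c = (Pi.single (Fin.last B) 1, 0)))) ∧ Bornology.IsBounded s.domain ∧ s.domain = {z | (∀ j, 0 < ∑ i, ((M j).1 i : ℝ) * z (Fin.castAdd K i) + ((M j).2 : ℝ)) ∧ ∀ i, Sum.elim (fun j => z (Fin.natAdd (B + 1) j)) (fun c => ∑ i', (c.1 i' : ℝ) * z (Fin.castAdd K i') + (c.2 : ℝ)) (lo i) < z (Fin.natAdd (B + 1) i) ∧ z (Fin.natAdd (B + 1) i) < Sum.elim (fun j => z (Fin.natAdd (B + 1) j)) (fun c => ∑ i', (c.1 i' : ℝ) * z (Fin.castAdd K i') + (c.2 : ℝ)) (hi i)} ∧ EqOn s.integrand (fun z => MvPolynomial.aeval (fun i => z (Fin.castAdd K (Fin.castSucc i))) p / (∏ j, (∑ i, ((L j).1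 i : ℝ) * z (Fin.castAdd K (Fin.castSucc i)) + ((L j).2 : ℝ)) ^ e j) * ((z (Fin.castAdd K (Fin.last B)) - (∑ i, (ℓ₁.1 i : ℝ) * z (Fin.castAdd K (Fin.castSucc i)) + (ℓ₁.2 : ℝ))) ^ n₁ / (z (Fin.castAdd K (Fin.last B)) - (∑ i, (ℓ₂.1 i : ℝ) * z (Fin.castAdd K (Fin.castSucc i)) + (ℓ₂.2 : ℝ))) ^ n₂) * ∏ i, (a i).elim 1 (fun c => 1 / (z (Fin.natAdd (B + 1) i) - (∑ i', (c.1 i' : ℝ) * z (Fin.castAdd K i') + (c.2 : ℝ))))) s.domain ∧ w = KZ.of s}, KZ.of s - c ∈ KZ.relations :=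
  RebasePos.good_levelSplit a u v s M L e p ℓ₁ ℓ₂ lo hi h12 hbd hdom hint hlo hhi i₀ κ hslope hκ hbetween


end Summit.KontsevichZagierPeriods.ArrangementNormalForm.JanusBands
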